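import Summits.Ventures.PercRepro.C041SquareMarksB

/-!
# THE SQUARE MAP AT MARKED VERTICES IS IN THE CONE — part C
(mine-3, gen 60; C-041.md §21 (ai))

Part C of the eighteen square identities at marked vertices (see `C041SquareMarksA`): the patterns
`O1O1O2, O1O2O1, O1O2O2, O2DO2, O2O1O2, O2O2O2`.
-/

namespace PercRepro

namespace RelaxedTriangle

open TreeClosure

/-- **THE SQUARE IDENTITY, types `O1 × O1 × O2`** (`D = X(p,q)`, `O1 = X(p,0)`, `O2 = X(0,q)`; all listed exponents `≥ 1`;
coefficients polynomial in the shifted variables `2^p − 2`, `2^q − 2` with non-negative coefficients). -/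
theorem square_O1O1O2 (p₁ p₂ q₃ : ℕ)
    (hp₁ : 1 ≤ p₁) (hp₂ : 1 ≤ p₂) (hq₃ : 1 ≤ q₃) :
    square (v 1 ^ p₁) (v 1 ^ p₂) (v 0 ^ q₃) =
      ((2 : ℝ) * sh p₂ * sh q₃ + (4 : ℝ) * sh q₃ + (9 / 2 : ℝ)) • v 0
      + ((8 : ℝ) * sh p₂ + (4 : ℝ)) • v (1 / 2)
      + ((2 : ℝ) * sh p₁ * sh p₂ * sh q₃ + (5 : ℝ) * sh p₁ * sh q₃ + (2 : ℝ) * sh p₁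
          + (3 : ℝ) * sh p₂ * sh q₃ + (2 : ℝ) * sh q₃ + (8 : ℝ)) • (v 0 * v 1)
      + ((63 / 2 : ℝ)) • v (2 / 3)
      + ((3 : ℝ)) • (v 1 * v 1)
      + ((2 : ℝ)) • (1 : Vec6)
      + ((9 : ℝ) * sh q₃) • (v 0 * v (2 / 3))
      + ((8 : ℝ) * sh p₁ * sh p₂ + (12 : ℝ) * sh p₁ + (12 : ℝ) * sh p₂) • (v 1 * v (1 / 2))
      + ((4 : ℝ) * sh p₁) • v 1 := by
  rw [pow_v_one_eq p₁ hp₁, pow_v_one_eq p₂ hp₂, pow_v_zero_eq q₃ hq₃]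
  ext i
  simp only [square, sqCol, jointVec, jv2, jv3, lo, hi, Pi.add_apply, Pi.mul_apply, Pi.smul_apply, Pi.one_apply,
    smul_eq_mul, thB, thR, nAdm, kInv, v, sh]
  fin_cases i <;> simp <;> ring

/-- The square with marked vertices of types `O1 × O1 × O2` lies in the cone. -/
theorem InCone_square_O1O1O2 (p₁ p₂ q₃ : ℕ)
    (hp₁ : 1 ≤ p₁) (hp₂ : 1 ≤ p₂) (hq₃ : 1 ≤ q₃) :
    InCone (square (v 1 ^ p₁) (v 1 ^ p₂) (v 0 ^ q₃)) := by
  rw [square_O1O1O2 p₁ p₂ q₃ hp₁ hp₂ hq₃]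
  have hap₁ : 0 ≤ sh p₁ := sh_nonneg p₁ hp₁
  have hap₂ : 0 ≤ sh p₂ := sh_nonneg p₂ hp₂
  have haq₃ : 0 ≤ sh q₃ := sh_nonneg q₃ hq₃
  exact ((((((((InCone.smul _ (by positivity) (InCone_v0)).add
    (InCone.smul _ (by positivity) (InCone_vh))).add
    (InCone.smul _ (by positivity) ((InCone_v0).mul InCone_v1))).add
    (InCone.smul _ (by positivity) (InCone_v_twothirds))).add
    (InCone.smul _ (by positivity) ((InCone_v1).mul InCone_v1))).add
    (InCone.smul _ (by positivity) (InCone_one))).add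
    (InCone.smul _ (by positivity) ((InCone_v0).mul InCone_v_twothirds))).add
    (InCone.smul _ (by positivity) ((InCone_v1).mul InCone_vh))).add
    (InCone.smul _ (by positivity) (InCone_v1))

/-- **THE SQUARE IDENTITY, types `O1 × O2 × O1`** (`D = X(p,q)`, `O1 = X(p,0)`, `O2 = X(0,q)`; all listed exponents `≥ 1`;
coefficients polynomial in the shifted variables `2^p − 2`, `2^q − 2` with non-negative coefficients). -/
theorem square_O1O2O1 (p₁ q₂ p₃ : ℕ)
    (hp₁ : 1 ≤ p₁) (hq₂ : 1 ≤ q₂) (hp₃ : 1 ≤ p₃) :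
    square (v 1 ^ p₁) (v 0 ^ q₂) (v 1 ^ p₃) =
      ((4 : ℝ)) • v (1 / 2)
      + ((4 : ℝ)) • (v 0 * v 1)
      + ((36 : ℝ)) • v (2 / 3)
      + ((1 : ℝ) * sh p₁ * sh q₂ * sh p₃ + (5 : ℝ) * sh p₁ * sh p₃ + (2 : ℝ) * sh p₁
          + (2 : ℝ) * sh p₃ + (6 : ℝ)) • (v 1 * v 1)
      + ((9 : ℝ) * sh p₁ + (9 : ℝ) * sh p₃) • (v 1 * v (2 / 3))
      + ((4 : ℝ) * sh p₁ + (4 : ℝ) * sh p₃) • v 1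
      + ((16 : ℝ) * sh q₂) • (v (1 / 2) * v (1 / 2))
      + ((4 : ℝ) * sh p₁ * sh q₂ + (4 : ℝ) * sh q₂ * sh p₃) • (v 1 * v (1 / 2)) := by
  rw [pow_v_one_eq p₁ hp₁, pow_v_zero_eq q₂ hq₂, pow_v_one_eq p₃ hp₃]
  ext i
  simp only [square, sqCol, jointVec, jv2, jv3, lo, hi, Pi.add_apply, Pi.mul_apply, Pi.smul_apply, Pi.one_apply,
    smul_eq_mul, thB, thR, nAdm, kInv, v, sh]
  fin_cases i <;> simp <;> ring

/-- The square with marked vertices of types `O1 × O2 × O1` lies in the cone. -/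
theorem InCone_square_O1O2O1 (p₁ q₂ p₃ : ℕ)
    (hp₁ : 1 ≤ p₁) (hq₂ : 1 ≤ q₂) (hp₃ : 1 ≤ p₃) :
    InCone (square (v 1 ^ p₁) (v 0 ^ q₂) (v 1 ^ p₃)) := by
  rw [square_O1O2O1 p₁ q₂ p₃ hp₁ hq₂ hp₃]
  have hap₁ : 0 ≤ sh p₁ := sh_nonneg p₁ hp₁
  have haq₂ : 0 ≤ sh q₂ := sh_nonneg q₂ hq₂
  have hap₃ : 0 ≤ sh p₃ := sh_nonneg p₃ hp₃
  exact (((((((InCone.smul _ (by positivity) (InCone_vh)).add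
    (InCone.smul _ (by positivity) ((InCone_v0).mul InCone_v1))).add
    (InCone.smul _ (by positivity) (InCone_v_twothirds))).add
    (InCone.smul _ (by positivity) ((InCone_v1).mul InCone_v1))).add
    (InCone.smul _ (by positivity) ((InCone_v1).mul InCone_v_twothirds))).add
    (InCone.smul _ (by positivity) (InCone_v1))).add
    (InCone.smul _ (by positivity) ((InCone_vh).mul InCone_vh))).add
    (InCone.smul _ (by positivity) ((InCone_v1).mul InCone_vh))

/-- **THE SQUARE IDENTITY, types `O1 × O2 × O2`** (`D = X(p,q)`, `O1 = X(p,0)`, `O2 = X(0,q)`; all listed exponents `≥ 1`;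
coefficients polynomial in the shifted variables `2^p − 2`, `2^q − 2` with non-negative coefficients). -/
theorem square_O1O2O2 (p₁ q₂ q₃ : ℕ)
    (hp₁ : 1 ≤ p₁) (hq₂ : 1 ≤ q₂) (hq₃ : 1 ≤ q₃) :
    square (v 1 ^ p₁) (v 0 ^ q₂) (v 0 ^ q₃) =
      ((4 : ℝ) * sh q₃ + (7 : ℝ)) • v 0
      + ((2 : ℝ) * sh p₁ * sh q₂ + (4 : ℝ) * sh p₁ + (1 : ℝ)) • v 1
      + ((2 : ℝ) * sh p₁ * sh q₂ * sh q₃ + (3 : ℝ) * sh p₁ * sh q₂ + (5 : ℝ) * sh p₁ * sh q₃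
          + (2 : ℝ) * sh p₁ + (2 : ℝ) * sh q₃ + (8 : ℝ)) • (v 0 * v 1)
      + ((2 : ℝ)) • (1 : Vec6)
      + ((8 : ℝ) * sh q₂ + (32 : ℝ)) • v (1 / 2)
      + ((3 : ℝ)) • (v 0 * v 0)
      + ((8 : ℝ) * sh q₂ * sh q₃ + (12 : ℝ) * sh q₂ + (12 : ℝ) * sh q₃) • (v 0 * v (1 / 2))
      + ((9 : ℝ) * sh p₁) • (v 1 * v (1 / 3)) := by
  rw [pow_v_one_eq p₁ hp₁, pow_v_zero_eq q₂ hq₂, pow_v_zero_eq q₃ hq₃]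
  ext i
  simp only [square, sqCol, jointVec, jv2, jv3, lo, hi, Pi.add_apply, Pi.mul_apply, Pi.smul_apply, Pi.one_apply,
    smul_eq_mul, thB, thR, nAdm, kInv, v, sh]
  fin_cases i <;> simp <;> ring

/-- The square with marked vertices of types `O1 × O2 × O2` lies in the cone. -/
theorem InCone_square_O1O2O2 (p₁ q₂ q₃ : ℕ)
    (hp₁ : 1 ≤ p₁) (hq₂ : 1 ≤ q₂) (hq₃ : 1 ≤ q₃) :
    InCone (square (v 1 ^ p₁) (v 0 ^ q₂) (v 0 ^ q₃)) := by
  rw [square_O1O2O2 p₁ q₂ q₃ hp₁ hq₂ hq₃]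
  have hap₁ : 0 ≤ sh p₁ := sh_nonneg p₁ hp₁
  have haq₂ : 0 ≤ sh q₂ := sh_nonneg q₂ hq₂
  have haq₃ : 0 ≤ sh q₃ := sh_nonneg q₃ hq₃
  exact (((((((InCone.smul _ (by positivity) (InCone_v0)).add
    (InCone.smul _ (by positivity) (InCone_v1))).add
    (InCone.smul _ (by positivity) ((InCone_v0).mul InCone_v1))).add
    (InCone.smul _ (by positivity) (InCone_one))).add
    (InCone.smul _ (by positivity) (InCone_vh))).add
    (InCone.smul _ (by positivity) ((InCone_v0).mul InCone_v0))).add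
    (InCone.smul _ (by positivity) ((InCone_v0).mul InCone_vh))).add
    (InCone.smul _ (by positivity) ((InCone_v1).mul InCone_v_third))

/-- **THE SQUARE IDENTITY, types `O2 × D × O2`** (`D = X(p,q)`, `O1 = X(p,0)`, `O2 = X(0,q)`; all listed exponents `≥ 1`;
coefficients polynomial in the shifted variables `2^p − 2`, `2^q − 2` with non-negative coefficients). -/
theorem square_O2DO2 (q₁ p₂ q₂ q₃ : ℕ)
    (hq₁ : 1 ≤ q₁) (hp₂ : 1 ≤ p₂) (hq₂ : 1 ≤ q₂) (hq₃ : 1 ≤ q₃) :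
    square (v 0 ^ q₁) (v 1 ^ p₂ * v 0 ^ q₂) (v 0 ^ q₃) =
      ((4 : ℝ) * sh q₁ * sh p₂ + (4 : ℝ) * sh p₂ * sh q₃ + (24 : ℝ)) • (v 0 * v (1 / 2))
      + ((1 : ℝ) * sh q₁ * sh p₂ * sh q₃ + (4 : ℝ) * sh q₁ * sh q₂ * sh q₃ + (6 : ℝ) * sh q₁ * sh q₂
          + (9 : ℝ) * sh q₁ * sh q₃ + (8 : ℝ) * sh q₁ + (6 : ℝ) * sh q₂ * sh q₃ + (9 : ℝ) * sh q₂
          + (8 : ℝ) * sh q₃ + (6 : ℝ)) • (v 0 * v 0)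
      + ((4 : ℝ) * sh q₂ + (6 : ℝ)) • (1 : Vec6)
      + ((27 : ℝ)) • v (1 / 3)
      + ((4 : ℝ) * sh q₁ * sh q₂ + (8 : ℝ) * sh q₁ + (4 : ℝ) * sh q₂ * sh q₃ + (12 : ℝ) * sh q₂
          + (8 : ℝ) * sh q₃ + (12 : ℝ)) • v 0
      + ((9 : ℝ) * sh q₁ + (9 : ℝ) * sh q₃) • (v 0 * v (1 / 3))
      + ((16 : ℝ) * sh p₂) • (v (1 / 2) * v (1 / 2)) := by
  rw [pow_v_zero_eq q₁ hq₁, pow_v_one_mul_pow_v_zero_eq p₂ q₂ hp₂ hq₂, pow_v_zero_eq q₃ hq₃]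
  ext i
  simp only [square, sqCol, jointVec, jv2, jv3, lo, hi, Pi.add_apply, Pi.mul_apply, Pi.smul_apply, Pi.one_apply,
    smul_eq_mul, thB, thR, nAdm, kInv, v, sh]
  fin_cases i <;> simp <;> ring

/-- The square with marked vertices of types `O2 × D × O2` lies in the cone. -/
theorem InCone_square_O2DO2 (q₁ p₂ q₂ q₃ : ℕ)
    (hq₁ : 1 ≤ q₁) (hp₂ : 1 ≤ p₂) (hq₂ : 1 ≤ q₂) (hq₃ : 1 ≤ q₃) :
    InCone (square (v 0 ^ q₁) (v 1 ^ p₂ * v 0 ^ q₂) (v 0 ^ q₃)) := by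
  rw [square_O2DO2 q₁ p₂ q₂ q₃ hq₁ hp₂ hq₂ hq₃]
  have haq₁ : 0 ≤ sh q₁ := sh_nonneg q₁ hq₁
  have hap₂ : 0 ≤ sh p₂ := sh_nonneg p₂ hp₂
  have haq₂ : 0 ≤ sh q₂ := sh_nonneg q₂ hq₂
  have haq₃ : 0 ≤ sh q₃ := sh_nonneg q₃ hq₃
  exact ((((((InCone.smul _ (by positivity) ((InCone_v0).mul InCone_vh)).add
    (InCone.smul _ (by positivity) ((InCone_v0).mul InCone_v0))).add
    (InCone.smul _ (by positivity) (InCone_one))).add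
    (InCone.smul _ (by positivity) (InCone_v_third))).add
    (InCone.smul _ (by positivity) (InCone_v0))).add
    (InCone.smul _ (by positivity) ((InCone_v0).mul InCone_v_third))).add
    (InCone.smul _ (by positivity) ((InCone_vh).mul InCone_vh))

/-- **THE SQUARE IDENTITY, types `O2 × O1 × O2`** (`D = X(p,q)`, `O1 = X(p,0)`, `O2 = X(0,q)`; all listed exponents `≥ 1`;
coefficients polynomial in the shifted variables `2^p − 2`, `2^q − 2` with non-negative coefficients). -/
theorem square_O2O1O2 (q₁ p₂ q₃ : ℕ)
    (hq₁ : 1 ≤ q₁) (hp₂ : 1 ≤ p₂) (hq₃ : 1 ≤ q₃) :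
    square (v 0 ^ q₁) (v 1 ^ p₂) (v 0 ^ q₃) =
      ((4 : ℝ)) • (v 0 * v 1)
      + ((36 : ℝ)) • v (1 / 3)
      + ((4 : ℝ)) • v (1 / 2)
      + ((1 : ℝ) * sh q₁ * sh p₂ * sh q₃ + (5 : ℝ) * sh q₁ * sh q₃ + (2 : ℝ) * sh q₁
          + (2 : ℝ) * sh q₃ + (6 : ℝ)) • (v 0 * v 0)
      + ((9 : ℝ) * sh q₁ + (9 : ℝ) * sh q₃) • (v 0 * v (1 / 3))
      + ((4 : ℝ) * sh q₁ + (4 : ℝ) * sh q₃) • v 0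
      + ((16 : ℝ) * sh p₂) • (v (1 / 2) * v (1 / 2))
      + ((4 : ℝ) * sh q₁ * sh p₂ + (4 : ℝ) * sh p₂ * sh q₃) • (v 0 * v (1 / 2)) := by
  rw [pow_v_zero_eq q₁ hq₁, pow_v_one_eq p₂ hp₂, pow_v_zero_eq q₃ hq₃]
  ext i
  simp only [square, sqCol, jointVec, jv2, jv3, lo, hi, Pi.add_apply, Pi.mul_apply, Pi.smul_apply, Pi.one_apply,
    smul_eq_mul, thB, thR, nAdm, kInv, v, sh]
  fin_cases i <;> simp <;> ring

/-- The square with marked vertices of types `O2 × O1 × O2` lies in the cone. -/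
theorem InCone_square_O2O1O2 (q₁ p₂ q₃ : ℕ)
    (hq₁ : 1 ≤ q₁) (hp₂ : 1 ≤ p₂) (hq₃ : 1 ≤ q₃) :
    InCone (square (v 0 ^ q₁) (v 1 ^ p₂) (v 0 ^ q₃)) := by
  rw [square_O2O1O2 q₁ p₂ q₃ hq₁ hp₂ hq₃]
  have haq₁ : 0 ≤ sh q₁ := sh_nonneg q₁ hq₁
  have hap₂ : 0 ≤ sh p₂ := sh_nonneg p₂ hp₂
  have haq₃ : 0 ≤ sh q₃ := sh_nonneg q₃ hq₃
  exact (((((((InCone.smul _ (by positivity) ((InCone_v0).mul InCone_v1)).add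
    (InCone.smul _ (by positivity) (InCone_v_third))).add
    (InCone.smul _ (by positivity) (InCone_vh))).add
    (InCone.smul _ (by positivity) ((InCone_v0).mul InCone_v0))).add
    (InCone.smul _ (by positivity) ((InCone_v0).mul InCone_v_third))).add
    (InCone.smul _ (by positivity) (InCone_v0))).add
    (InCone.smul _ (by positivity) ((InCone_vh).mul InCone_vh))).add
    (InCone.smul _ (by positivity) ((InCone_v0).mul InCone_vh))

/-- **THE SQUARE IDENTITY, types `O2 × O2 × O2`** (`D = X(p,q)`, `O1 = X(p,0)`, `O2 = X(0,q)`; all listed exponents `≥ 1`;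
coefficients polynomial in the shifted variables `2^p − 2`, `2^q − 2` with non-negative coefficients). -/
theorem square_O2O2O2 (q₁ q₂ q₃ : ℕ)
    (hq₁ : 1 ≤ q₁) (hq₂ : 1 ≤ q₂) (hq₃ : 1 ≤ q₃) :
    square (v 0 ^ q₁) (v 0 ^ q₂) (v 0 ^ q₃) =
      ((4 : ℝ) * sh q₁ * sh q₂ + (10 : ℝ) * sh q₁ + (4 : ℝ) * sh q₂ * sh q₃ + (12 : ℝ) * sh q₂
          + (10 : ℝ) * sh q₃ + (33 : ℝ)) • v 0
      + ((4 : ℝ) * sh q₁ * sh q₂ * sh q₃ + (6 : ℝ) * sh q₁ * sh q₂ + (8 : ℝ) * sh q₁ * sh q₃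
          + (11 : ℝ) * sh q₁ + (6 : ℝ) * sh q₂ * sh q₃ + (9 : ℝ) * sh q₂ + (11 : ℝ) * sh q₃
          + (12 : ℝ)) • (v 0 * v 0)
      + ((4 : ℝ) * sh q₂ + (14 : ℝ)) • (1 : Vec6) := by
  rw [pow_v_zero_eq q₁ hq₁, pow_v_zero_eq q₂ hq₂, pow_v_zero_eq q₃ hq₃]
  ext i
  simp only [square, sqCol, jointVec, jv2, jv3, lo, hi, Pi.add_apply, Pi.mul_apply, Pi.smul_apply, Pi.one_apply,
    smul_eq_mul, thB, thR, nAdm, kInv, v, sh]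
  fin_cases i <;> simp <;> ring

/-- The square with marked vertices of types `O2 × O2 × O2` lies in the cone. -/
theorem InCone_square_O2O2O2 (q₁ q₂ q₃ : ℕ)
    (hq₁ : 1 ≤ q₁) (hq₂ : 1 ≤ q₂) (hq₃ : 1 ≤ q₃) :
    InCone (square (v 0 ^ q₁) (v 0 ^ q₂) (v 0 ^ q₃)) := by
  rw [square_O2O2O2 q₁ q₂ q₃ hq₁ hq₂ hq₃]
  have haq₁ : 0 ≤ sh q₁ := sh_nonneg q₁ hq₁
  have haq₂ : 0 ≤ sh q₂ := sh_nonneg q₂ hq₂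
  have haq₃ : 0 ≤ sh q₃ := sh_nonneg q₃ hq₃
  exact ((InCone.smul _ (by positivity) (InCone_v0)).add
    (InCone.smul _ (by positivity) ((InCone_v0).mul InCone_v0))).add
    (InCone.smul _ (by positivity) (InCone_one))

end RelaxedTriangle

end PercRepro
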